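import Mathlib
import Summits.Ventures.PercRepro2.Defs
import Summits.Ventures.PercRepro2.Graph
import Summits.Ventures.PercRepro2.OneColourSwitch
import Summits.Ventures.PercRepro2.M9PendantMirror
import Summits.Ventures.PercRepro2.M9LoopTransfer
import Summits.Ventures.PercRepro2.M9PendantSeries
import Summits.Ventures.PercRepro2.M9ReducibleClass
import Summits.Ventures.PercRepro2.M9ParallelContract

/-!
# The series–parallel reducible class for `m9` (blind cell PercRepro2, p3 g19, 2026-08-27)

`ReducibleSP p q r s ends` extends `Reducible` (`M9ReducibleClass`: the `DZero` and cut-vertex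
bases, the pair swap, the pendant and series reductions) by the PARALLEL reduction of
`M9ParallelContract`: a parallel pair `{x, y}` at a non-mark `y` is one edge (with `e₂` looped)
or the contraction `y ↦ x`.  `m9SignSum_nonpos_of_reducibleSP` proves `Σ_{Sep} σ_pq · σ_rs ≤ 0`
on the whole class: every marked multigraph that series–parallel-reduces at non-marks to a
`DZero` graph or a cut-vertex graph.  Own work, one seat.
-/

namespace Summit.Ventures.PercRepro2

namespace M9Reduce

open OneColourSwitch Classical Finset

variable {V : Type*} {E : Type*}

section ReducibleSP

variable [Fintype V] [DecidableEq V] [Fintype E] [DecidableEq E]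

/-- The series–parallel reducible class: `Reducible`, closed further under the pair swap, the
pendant, series and parallel reductions. -/
inductive ReducibleSP : V → V → V → V → (E → Sym2 V) → Prop
  /-- every `Reducible` graph -/
  | ofReducible {p q r s : V} {ends : E → Sym2 V} (h : Reducible p q r s ends) :
      ReducibleSP p q r s ends
  /-- the pair swap -/
  | swap {p q r s : V} {ends : E → Sym2 V} (h : ReducibleSP r s p q ends) :
      ReducibleSP p q r s ends
  /-- the pendant reduction -/
  | pendant {p q r s : V} {ends : E → Sym2 V} {e₀ : E} {d v : V}
      (hd : ∀ e, d ∈ ends e → ¬ (ends e).IsDiag → e = e₀) (he₀ : ends e₀ = s(d, v))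
      (hp : p ≠ d) (hq : q ≠ d) (hr : r ≠ d) (hs : s ≠ d)
      (h : ReducibleSP p q r s (Function.update ends e₀ s(d, d))) : ReducibleSP p q r s ends
  /-- the series reduction -/
  | series {p q r s : V} {ends : E → Sym2 V} {e₁ e₂ : E} {d x y : V} (hne : e₁ ≠ e₂)
      (hd : ∀ e, d ∈ ends e → ¬ (ends e).IsDiag → e = e₁ ∨ e = e₂)
      (h₁ : ends e₁ = s(d, x)) (h₂ : ends e₂ = s(d, y)) (hx : x ≠ d) (hy : y ≠ d)
      (hp : p ≠ d) (hq : q ≠ d) (hr : r ≠ d) (hs : s ≠ d)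
      (hG₁ : ReducibleSP p q r s (Function.update (Function.update ends e₁ s(x, y)) e₂ s(d, d)))
      (hG₀ : ReducibleSP p q r s (Function.update (Function.update ends e₁ s(d, d)) e₂ s(d, d))) :
      ReducibleSP p q r s ends
  /-- the parallel reduction: a parallel pair `{x, y}`, `y` a non-mark, is one edge or the
  contraction `y ↦ x` -/
  | parallel {p q r s : V} {ends : E → Sym2 V} {e₁ e₂ : E} {x y : V} (hne : e₁ ≠ e₂)
      (h₁ : ends e₁ = s(x, y)) (h₂ : ends e₂ = s(x, y))
      (hp : p ≠ y) (hq : q ≠ y) (hr : r ≠ y) (hs : s ≠ y)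
      (hG₁ : ReducibleSP p q r s (Function.update ends e₂ s(x, x)))
      (hGc : ReducibleSP p q r s (contract ends x y)) : ReducibleSP p q r s ends

/-- **`m9` in sign form on the series–parallel reducible class**: `Σ_{Sep} σ_pq · σ_rs ≤ 0` on
every marked multigraph that series–parallel-reduces at non-marks to a `DZero` graph or a
cut-vertex graph. -/
theorem m9SignSum_nonpos_of_reducibleSP {p q r s : V} {ends : E → Sym2 V}
    (h : ReducibleSP p q r s ends) : m9SignSum ends p q r s ≤ 0 := by
  induction h with
  | ofReducible h => exact m9SignSum_nonpos_of_reducible h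
  | swap _ ih => rw [m9SignSum_comm]; exact ih
  | pendant hd he₀ hp hq hr hs _ ih => rw [m9SignSum_pendant hd he₀ hp hq hr hs]; exact ih
  | series hne hd h₁ h₂ hx hy hp hq hr hs _ _ ih₁ ih₀ =>
    have hid := m9SignSum_series hne hd h₁ h₂ hx hy hp hq hr hs
    linarith
  | parallel hne h₁ h₂ hp hq hr hs _ _ ih₁ ihc =>
    exact m9SignSum_nonpos_of_parallel hne h₁ h₂ hp hq hr hs ih₁ ihc

end ReducibleSP

end M9Reduce

end Summit.Ventures.PercRepro2
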